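import Summits.CriticalPhenomena.PercolationContinuityZ3.Theorems.PercNearOneGluingNoHeavyLowerTailKnQuestion8CoefficientwiseCoreClassKernelMixTwoStageFull
import Summits.CriticalPhenomena.PercolationContinuityZ3.Theorems.PercNearOneGluingNoHeavyLowerTailKnQuestion8CoefficientwiseCoreClassKernelMixHallWitness
import Summits.CriticalPhenomena.PercolationContinuityZ3.Theorems.PercNearOneGluingNoHeavyLowerTailKnQuestion8CoefficientwiseCoreClassKernelMixHSpace

/-!
# The rider-free FULL step, concrete two-stage form (THEOREM RF), and FULL from THEOREM A's invariant H

Support file (`--supports stmt-CriticalPhenomena-4575`, closed), prover `prim-cplus-coupling` (gen 73).  No definitions, no notations, no named facts,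
no sorries; standard axioms.  Memo `prim-cplus-coupling/A5-COUPLING-gen73.md` §3.

FULL data for a pair of finsets `D, B` of a preordered type with mirror `c` and witness region `G` are: maps `ψ₁, ψ₂` increasing and injective on
`D`, `B` with mirrored values back in the level (`c (ψ₁ y) ∈ D`), and a map `ω` on pairs, injective on the coincident pairs `ψ₁ y₁ = ψ₂ y₂`, with
`ω (y₁,y₂) ∈ G` above both.  (We keep this expanded; no definition is introduced.)
* `count_of_witnesses`: FULL data give the Hall-form count (the easy direction).
* `full_of_hspace`: THEOREM A's invariant H (`HSpace.IsHSpace`) gives FULL data with region `NF` for every pair of levels, the maps being the canonical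
  matchings `Φ D`, `Φ B` (Hall's theorem via `HallWitness.exists_witnesses_of_count`).
* `full_step` (THEOREM RF of the memo, two-stage form): on `Z = X × Y` (`Y` the outermost cycle with bottom word `botY`, full word `topY`, mirror `cY`)
  let `D, B ⊆ X × Y` be the chordless pair, with inner fibre maps that are increasing, mirror-valued, injective on fibres, are POLAR
  (only `botY` is sent to `topY`; the `D`-side map never hits `botY`).  If every row pair `(D_{cY v}, B_{cY v})`, `v ≠ topY`, has FULL data with region `GX` and the row pair of `topY`
  (the chorded pair `(D_⊥, B_⊥)`) has FULL data with region `NFX`, and `GZ ⊇ GX × (Y ∖ {topY}) ∪ NFX × {botY}`, then `(D, B)` has FULL data on `Z`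
  with mirror `(cX, cY)` and region `GZ`, the maps being the two-stage maps.
[cite: KozmaNitzan2024, Questions 8–9 (§5.5 p. 36) (context); Harris 1960; Kleitman 1966]
-/

namespace Summit.CriticalPhenomena.PercolationContinuityZ3.Theorems.Coefficientwise.FullStep

open Finset ReducedKleitman TwoStageProduct TwoStageFull HallWitness HSpace

variable {X Y : Type*} [Fintype X] [DecidableEq X] [Preorder X] [Fintype Y] [DecidableEq Y] [Preorder Y]

open Classical in
/-- **FULL data give the Hall count**: if the coincident pairs of `ψ₁, ψ₂` on `D × B` carry distinct witnesses in `G` above both components, then the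
coincident pairs whose common upper cone lies in an upper set `U` number at most `#(U ∩ G)`. -/
theorem count_of_witnesses (D B G : Finset X) (ψ₁ ψ₂ : X → X) (ω : X × X → X)
    (hω : ∀ y₁ ∈ D, ∀ y₂ ∈ B, ψ₁ y₁ = ψ₂ y₂ → y₁ ≤ ω (y₁, y₂) ∧ y₂ ≤ ω (y₁, y₂) ∧ ω (y₁, y₂) ∈ G)
    (hωinj : Set.InjOn ω (((D ×ˢ B).filter (fun p => ψ₁ p.1 = ψ₂ p.2) : Finset (X × X)) : Set (X × X)))
    (U : Finset X) :
    (((D ×ˢ B).filter (fun p => ψ₁ p.1 = ψ₂ p.2)).filter (fun p => ∀ q : X, p.1 ≤ q → p.2 ≤ q → q ∈ U)).card ≤ (U ∩ G).card := by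
  refine card_le_card_of_injOn ω ?_ (hωinj.mono ?_)
  · intro p hp
    rw [mem_coe, mem_filter] at hp
    obtain ⟨hp1, hcone⟩ := hp
    obtain ⟨hpDB, he⟩ := mem_filter.mp hp1
    obtain ⟨hD, hB⟩ := mem_product.mp hpDB
    obtain ⟨h1, h2, hG⟩ := hω p.1 hD p.2 hB he
    exact mem_coe.mpr (mem_inter.mpr ⟨hcone _ h1 h2, hG⟩)
  · intro p hp
    exact mem_coe.mpr (mem_filter.mp (mem_coe.mp hp)).1

open Classical in
/-- **THEOREM A ⟹ FULL with region `NF`.**  In an H-space, for two levels `D, B` the canonical matchings `Φ D, Φ B` are increasing, injective,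
mirror-valued, and ALL their coincident pairs admit distinct witnesses in `NF` above both components. -/
theorem full_of_hspace {NF : Finset X} {c : X → X} {Level : Finset X → Prop} {Φ : Finset X → X → X}
    (hH : IsHSpace NF c Level Φ) (D B : Finset X) (hD : Level D) (hB : Level B) :
    ∃ ω : X × X → X, Set.InjOn ω (((D ×ˢ B).filter (fun p => Φ D p.1 = Φ B p.2) : Finset (X × X)) : Set (X × X)) ∧
      ∀ y₁ ∈ D, ∀ y₂ ∈ B, Φ D y₁ = Φ B y₂ → y₁ ≤ ω (y₁, y₂) ∧ y₂ ≤ ω (y₁, y₂) ∧ ω (y₁, y₂) ∈ NF := by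
  set Coll : Finset (X × X) := (D ×ˢ B).filter (fun p => Φ D p.1 = Φ B p.2) with hColl
  have hcount : ∀ W : Finset X, IsUpperSet (W : Set X) →
      (Coll.filter (fun c' => ∀ q : X, c'.1 ≤ q → c'.2 ≤ q → q ∈ W)).card ≤ (W ∩ NF).card := by
    intro W hW
    refine hH.hall D B hD hB W hW _ ?_ ?_
    · intro p hp
      exact (mem_filter.mp (mem_filter.mp hp).1).1
    · intro p hp
      obtain ⟨hp1, hcone⟩ := mem_filter.mp hp
      exact ⟨(mem_filter.mp hp1).2, hcone⟩
  obtain ⟨ω, hinj, hω⟩ := exists_witnesses_of_count Coll NF hcount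
  refine ⟨ω, hinj, ?_⟩
  intro y₁ hy₁ y₂ hy₂ he
  have hmem : (y₁, y₂) ∈ Coll := mem_filter.mpr ⟨mem_product.mpr ⟨hy₁, hy₂⟩, he⟩
  obtain ⟨hG, h1, h2⟩ := hω (y₁, y₂) hmem
  exact ⟨h1, h2, hG⟩

open Classical in
/-- **THEOREM RF (rider-free FULL step, two-stage form).**  See the module docstring.  The row hypotheses `hrow` (rows `v ≠ topY`, region `GX`)
and `htop` (row `topY`, region `NFX`) are FULL data of the row pairs `(D_{cY v}, B_{cY v})`; the fibre maps `φD, φB` are increasing, mirror-valued,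
injective on fibres, avoid `botY` and are polar; the conclusion is FULL data for `(D, B)` on `X × Y` with region `GZ`. -/
theorem full_step (D B : Finset (X × Y)) (cX : X → X) (cY : Y → Y) (GX NFX : Finset X) (GZ : Finset (X × Y)) (botY topY : Y)
    (φD φB : X → Y → Y)
    (hGZ : ∀ x v, (x ∈ GX ∧ v ≠ topY) ∨ (x ∈ NFX ∧ v = botY) → (x, v) ∈ GZ)
    (hinD : ∀ x y, (x, y) ∈ D → y ≤ φD x y ∧ (x, cY (φD x y)) ∈ D)
    (hinB : ∀ x y, (x, y) ∈ B → y ≤ φB x y ∧ (x, cY (φB x y)) ∈ B)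
    (hinD_inj : ∀ x y y', (x, y) ∈ D → (x, y') ∈ D → φD x y = φD x y' → y = y')
    (hinB_inj : ∀ x y y', (x, y) ∈ B → (x, y') ∈ B → φB x y = φB x y' → y = y')
    (hneD : ∀ x y, (x, y) ∈ D → φD x y ≠ botY)
    (hpolD : ∀ x y, (x, y) ∈ D → φD x y = topY → y = botY) (hpolB : ∀ x y, (x, y) ∈ B → φB x y = topY → y = botY)
    (hrow : ∀ v : Y, ∃ ψ₁ ψ₂ : X → X, ∃ ω : X × X → X,
      (∀ y ∈ fibR D (cY v), y ≤ ψ₁ y ∧ cX (ψ₁ y) ∈ fibR D (cY v)) ∧ Set.InjOn ψ₁ ((fibR D (cY v) : Finset X) : Set X) ∧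
      (∀ y ∈ fibR B (cY v), y ≤ ψ₂ y ∧ cX (ψ₂ y) ∈ fibR B (cY v)) ∧ Set.InjOn ψ₂ ((fibR B (cY v) : Finset X) : Set X) ∧
      (∀ y₁ ∈ fibR D (cY v), ∀ y₂ ∈ fibR B (cY v), ψ₁ y₁ = ψ₂ y₂ →
        y₁ ≤ ω (y₁, y₂) ∧ y₂ ≤ ω (y₁, y₂) ∧ ω (y₁, y₂) ∈ (if v = topY then NFX else GX)) ∧
      Set.InjOn ω (((fibR D (cY v) ×ˢ fibR B (cY v)).filter (fun p => ψ₁ p.1 = ψ₂ p.2) : Finset (X × X)) : Set (X × X))) :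
    ∃ ΨD ΨB : X × Y → X × Y, ∃ Ω : (X × Y) × (X × Y) → X × Y,
      (∀ z ∈ D, z ≤ ΨD z ∧ (cX (ΨD z).1, cY (ΨD z).2) ∈ D) ∧ Set.InjOn ΨD (D : Set (X × Y)) ∧
      (∀ z ∈ B, z ≤ ΨB z ∧ (cX (ΨB z).1, cY (ΨB z).2) ∈ B) ∧ Set.InjOn ΨB (B : Set (X × Y)) ∧
      (∀ z₁ ∈ D, ∀ z₂ ∈ B, ΨD z₁ = ΨB z₂ → z₁ ≤ Ω (z₁, z₂) ∧ z₂ ≤ Ω (z₁, z₂) ∧ Ω (z₁, z₂) ∈ GZ) ∧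
      Set.InjOn Ω (((D ×ˢ B).filter (fun p => ΨD p.1 = ΨB p.2) : Finset ((X × Y) × (X × Y))) : Set ((X × Y) × (X × Y))) := by
  -- choose the row solutions
  choose ψ₁ ψ₂ ω hψ₁ hψ₁inj hψ₂ hψ₂inj hω hωinj using hrow
  -- outer hypotheses in the form of `TwoStageProduct`
  have houtD : ∀ v x, (x, cY v) ∈ D → x ≤ ψ₁ v x ∧ (cX (ψ₁ v x), cY v) ∈ D := by
    intro v x hx
    have h := hψ₁ v x (mem_fibR.mpr hx)
    exact ⟨h.1, mem_fibR.mp h.2⟩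
  have houtB : ∀ v x, (x, cY v) ∈ B → x ≤ ψ₂ v x ∧ (cX (ψ₂ v x), cY v) ∈ B := by
    intro v x hx
    have h := hψ₂ v x (mem_fibR.mpr hx)
    exact ⟨h.1, mem_fibR.mp h.2⟩
  have houtD_inj : ∀ v x x', (x, cY v) ∈ D → (x', cY v) ∈ D → ψ₁ v x = ψ₁ v x' → x = x' :=
    fun v x x' hx hx' e => hψ₁inj v (mem_coe.mpr (mem_fibR.mpr hx)) (mem_coe.mpr (mem_fibR.mpr hx')) e
  have houtB_inj : ∀ v x x', (x, cY v) ∈ B → (x', cY v) ∈ B → ψ₂ v x = ψ₂ v x' → x = x' :=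
    fun v x x' hx hx' e => hψ₂inj v (mem_coe.mpr (mem_fibR.mpr hx)) (mem_coe.mpr (mem_fibR.mpr hx')) e
  have hinD' : ∀ x y, (x, y) ∈ D → (x, cY (φD x y)) ∈ D := fun x y h => (hinD x y h).2
  have hinB' : ∀ x y, (x, y) ∈ B → (x, cY (φB x y)) ∈ B := fun x y h => (hinB x y h).2
  -- (4): the Hall count on Z via `two_stage_full_count`
  have hrowD : ∀ x y, (x, y) ∈ D → φD x y ∈ univ.erase botY := fun x y h => mem_erase.mpr ⟨hneD x y h, mem_univ _⟩
  have hlaminj : Set.InjOn (fun v => if v = topY then botY else v) ((univ.erase botY : Finset Y) : Set Y) := by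
    intro a ha b hb hab
    have ha' : a ≠ botY := (mem_erase.mp (mem_coe.mp ha)).1
    have hb' : b ≠ botY := (mem_erase.mp (mem_coe.mp hb)).1
    dsimp only at hab
    by_cases h1 : a = topY <;> by_cases h2 : b = topY
    · rw [h1, h2]
    · rw [if_pos h1, if_neg h2] at hab; exact absurd hab.symm hb'
    · rw [if_neg h1, if_pos h2] at hab; exact absurd hab ha'
    · rw [if_neg h1, if_neg h2] at hab; exact hab
  have hRG : ∀ v ∈ (univ.erase botY : Finset Y), ∀ x ∈ (fun v => if v = topY then NFX else GX) v,
      (x, (fun v => if v = topY then botY else v) v) ∈ GZ := by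
    intro v _ x hx
    dsimp only at hx ⊢
    by_cases h : v = topY
    · rw [if_pos h] at hx ⊢; exact hGZ x botY (Or.inr ⟨hx, rfl⟩)
    · rw [if_neg h] at hx ⊢; exact hGZ x v (Or.inl ⟨hx, h⟩)
  have hlayD : ∀ x y, (x, y) ∈ D → y ≤ (fun v => if v = topY then botY else v) (φD x y) := by
    intro x y h
    dsimp only
    by_cases ht : φD x y = topY
    · rw [if_pos ht, hpolD x y h ht]
    · rw [if_neg ht]; exact (hinD x y h).1
  have hlayB : ∀ x y, (x, y) ∈ B → y ≤ (fun v => if v = topY then botY else v) (φB x y) := by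
    intro x y h
    dsimp only
    by_cases ht : φB x y = topY
    · rw [if_pos ht, hpolB x y h ht]
    · rw [if_neg ht]; exact (hinB x y h).1
  have hH : ∀ v ∈ (univ.erase botY : Finset Y), ∀ U : Finset X, IsUpperSet (U : Set X) →
      (((fibR D (cY v) ×ˢ fibR B (cY v)).filter (fun p => ψ₁ v p.1 = ψ₂ v p.2)).filter
        (fun p => ∀ q : X, p.1 ≤ q → p.2 ≤ q → q ∈ U)).card ≤ (U ∩ (fun v => if v = topY then NFX else GX) v).card := by
    intro v _ U _
    exact count_of_witnesses (fibR D (cY v)) (fibR B (cY v)) (if v = topY then NFX else GX) (ψ₁ v) (ψ₂ v) (ω v) (hω v) (hωinj v) U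
  have hcount : ∀ W : Finset (X × Y), IsUpperSet (W : Set (X × Y)) →
      (((D ×ˢ B).filter (fun c => (ψ₁ (φD c.1.1 c.1.2) c.1.1, φD c.1.1 c.1.2) = (ψ₂ (φB c.2.1 c.2.2) c.2.1, φB c.2.1 c.2.2))).filter
        (fun c => ∀ q : X × Y, c.1 ≤ q → c.2 ≤ q → q ∈ W)).card ≤ (W ∩ GZ).card :=
    fun W hW => two_stage_full_count D B cY φD φB ψ₁ ψ₂ (univ.erase botY) (fun v => if v = topY then botY else v)
      (fun v => if v = topY then NFX else GX) GZ hinD' hinB' hinD_inj hinB_inj hrowD hlaminj hRG hlayD hlayB hH W hW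
  -- (5): witnesses by Hall
  obtain ⟨Ω, hΩinj, hΩ⟩ := exists_witnesses_of_count
    ((D ×ˢ B).filter (fun c => (ψ₁ (φD c.1.1 c.1.2) c.1.1, φD c.1.1 c.1.2) = (ψ₂ (φB c.2.1 c.2.2) c.2.1, φB c.2.1 c.2.2))) GZ
    (fun W hW => by
      have h := hcount W hW
      convert h using 2
      ext c
      simp only [Finset.mem_filter])
  refine ⟨fun z => (ψ₁ (φD z.1 z.2) z.1, φD z.1 z.2), fun z => (ψ₂ (φB z.1 z.2) z.1, φB z.1 z.2), Ω, ?_, ?_, ?_, ?_, ?_, ?_⟩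
  rotate_left 5
  · intro a ha b hb hab
    have ha' := mem_filter.mp (mem_coe.mp ha)
    have hb' := mem_filter.mp (mem_coe.mp hb)
    exact hΩinj (mem_coe.mpr (mem_filter.mpr ⟨ha'.1, ha'.2⟩)) (mem_coe.mpr (mem_filter.mpr ⟨hb'.1, hb'.2⟩)) hab
  · intro z hz
    exact ⟨two_stage_increasing D cX cY φD ψ₁ hinD houtD z hz,
      two_stage_mirror D cX cY φD ψ₁ hinD' (fun v x h => (houtD v x h).2) z hz⟩
  · intro z hz z' hz' h
    exact two_stage_injOn D cY φD ψ₁ hinD' hinD_inj houtD_inj z z' (mem_coe.mp hz) (mem_coe.mp hz') h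
  · intro z hz
    exact ⟨two_stage_increasing B cX cY φB ψ₂ hinB houtB z hz,
      two_stage_mirror B cX cY φB ψ₂ hinB' (fun v x h => (houtB v x h).2) z hz⟩
  · intro z hz z' hz' h
    exact two_stage_injOn B cY φB ψ₂ hinB' hinB_inj houtB_inj z z' (mem_coe.mp hz) (mem_coe.mp hz') h
  · intro z₁ hz₁ z₂ hz₂ he
    have hmem : (z₁, z₂) ∈ (D ×ˢ B).filter
        (fun c => (ψ₁ (φD c.1.1 c.1.2) c.1.1, φD c.1.1 c.1.2) = (ψ₂ (φB c.2.1 c.2.2) c.2.1, φB c.2.1 c.2.2)) :=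
      mem_filter.mpr ⟨mem_product.mpr ⟨hz₁, hz₂⟩, he⟩
    obtain ⟨hG, h1, h2⟩ := hΩ (z₁, z₂) hmem
    exact ⟨h1, h2, hG⟩

end Summit.CriticalPhenomena.PercolationContinuityZ3.Theorems.Coefficientwise.FullStep
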